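import Summits.Ventures.Crystal3D.Theorems.StickyWulffConstantCoaxialWallLawWordRootSeparation
import HarnessLib

/-!
# LEMMA X at every version: movers from different roots have different targets, WHATEVER the move
# (crux `CoaxialWallLaw`, stmt-Ventures-19481, line `WallLedgerF`; v2 transition)

HONEST FRAMING. Venture `Summits/Ventures/Crystal3D` (cell `crystal3d-full`), helper `--supports` the crux
`CoaxialWallLaw` of `route-Ventures-StickyWulffConstant` (REGISTERED line `WallLedgerF`).  Rung credit; F-C1 not
moved; no census, no kissing facts; pure word algebra on top of `…WordRootSeparation`.  cf-p1 g28 (xxxviii″): the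
census key is `WordVersion.v2` (NARROW move); the v1 LEMMA X `word_target_ne_of_roots_ne` (`…EndUniqueMulti`) was proved
from the twelve-ball readings and does not cover NARROW movers (four balls).  Here the readings are IRRELEVANT: a move
from `p` in class `(F κ, d)` has target `p + d` (STRAIGHT: full, glide, narrow, …) or `p − M_m d` for a menu normal `m`
of `F κ` crossing `d` upward (CROSS), and

* `word_dir_ne_lists` — root separation, list form: `F κ₁ x₁ ≠ F κ₂ x₂` for chains with letters oblique to the slots
  `x₁ ≠ ±x₂`;
* `word_dir_reflect_eq` — a crossed direction is again a direction of the same root: `M_m (F κ (c•r)) = F κ' (c•r)` with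
  `κ'` the once-extended chain (or the once-shortened one when `m` is the last crossing plane), still a `±1/3`-chain of
  unit model menu normals oblique to `r`;
* **`word_target_ne_of_roots_ne_shape`** — for `±1/3`-chains `κ₁, κ₂` with letters oblique to the roots `r₁ ≠ ±r₂`:
  STRAIGHT/STRAIGHT, STRAIGHT/CROSS and CROSS/CROSS targets of `(F κ₁, ±F κ₁ r₁)` and `(F κ₂, ±F κ₂ r₂)` at one ball never
  coincide.  This is LEMMA X for v1 AND v2 (and any future straight-type move), with NO separation hypothesis on `X`.
WHAT THIS IS NOT: the v2 word chain (next files); F-C1 not moved.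
-/

noncomputable section

namespace Summit.Ventures.Crystal3D.Theorems

open Summit.Ventures.Crystal3D Finset
open Literature.MathematicalPhysics.StatisticalMechanics (fccStacking)
open scoped InnerProductSpace

variable {F : List (EuclideanSpace ℝ (Fin 3)) → (EuclideanSpace ℝ (Fin 3) ≃ₗᵢ[ℝ] EuclideanSpace ℝ (Fin 3))}

/-- **Root separation, list form**: `F κ₁ x₁ ≠ F κ₂ x₂`. -/
theorem word_dir_ne_lists (hFc : ∀ μ κ, F (μ :: κ) = ((ℝ ∙ μ)ᗮ.reflection).trans (F κ))
    {κ₁ κ₂ : List (EuclideanSpace ℝ (Fin 3))}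
    (hκ₁ : ∀ μ ∈ κ₁, ‖μ‖ = 1 ∧
      ∀ w ∈ fccSlots, ⟪w, μ⟫_ℝ = 0 ∨ ⟪w, μ⟫_ℝ = Real.sqrt (2 / 3) ∨ ⟪w, μ⟫_ℝ = -Real.sqrt (2 / 3))
    (hκ₂ : ∀ μ ∈ κ₂, ‖μ‖ = 1 ∧
      ∀ w ∈ fccSlots, ⟪w, μ⟫_ℝ = 0 ∨ ⟪w, μ⟫_ℝ = Real.sqrt (2 / 3) ∨ ⟪w, μ⟫_ℝ = -Real.sqrt (2 / 3))
    (hch₁ : List.IsChain (fun μ μ' => ⟪μ, μ'⟫_ℝ = 1 / 3 ∨ ⟪μ, μ'⟫_ℝ = -1 / 3) κ₁)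
    (hch₂ : List.IsChain (fun μ μ' => ⟪μ, μ'⟫_ℝ = 1 / 3 ∨ ⟪μ, μ'⟫_ℝ = -1 / 3) κ₂)
    {x₁ x₂ : EuclideanSpace ℝ (Fin 3)} (hx₁ : x₁ ∈ fccSlots) (hx₂ : x₂ ∈ fccSlots) (hne : x₁ ≠ x₂) (hne' : x₁ ≠ -x₂)
    (hob₁ : ∀ μ ∈ κ₁, ⟪x₁, μ⟫_ℝ = Real.sqrt (2 / 3) ∨ ⟪x₁, μ⟫_ℝ = -Real.sqrt (2 / 3))
    (hob₂ : ∀ μ ∈ κ₂, ⟪x₂, μ⟫_ℝ = Real.sqrt (2 / 3) ∨ ⟪x₂, μ⟫_ℝ = -Real.sqrt (2 / 3)) :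
    F κ₁ x₁ ≠ F κ₂ x₂ := by
  intro h
  have e₁ := word_F_append_apply hFc κ₁ (fun μ hμ => (hκ₁ μ hμ).1) [] x₁
  have e₂ := word_F_append_apply hFc κ₂ (fun μ hμ => (hκ₂ μ hμ).1) [] x₂
  rw [List.append_nil] at e₁ e₂
  rw [e₁, e₂] at h
  exact foldl_reflect_slot_ne κ₁ κ₂ hκ₁ hκ₂ hch₁ hch₂ hx₁ hx₂ hne hne' hob₁ hob₂ ((F []).injective h)

/-- **A crossed direction is a direction of the same root.**  For a chain `κ` (unit model menu letters, `±1/3`-chain,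
all oblique to the slot `x`), a unit menu normal `m` of `F κ` crossing `F κ x` (`⟪F κ x, m⟫ = ±√(2/3)`):
`M_m (F κ x) = F κ' x` for a chain `κ'` of the same kind. -/
theorem word_dir_reflect_eq (hFc : ∀ μ κ, F (μ :: κ) = ((ℝ ∙ μ)ᗮ.reflection).trans (F κ))
    {κ : List (EuclideanSpace ℝ (Fin 3))}
    (hκ : ∀ μ ∈ κ, ‖μ‖ = 1 ∧
      ∀ w ∈ fccSlots, ⟪w, μ⟫_ℝ = 0 ∨ ⟪w, μ⟫_ℝ = Real.sqrt (2 / 3) ∨ ⟪w, μ⟫_ℝ = -Real.sqrt (2 / 3))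
    (hch : List.IsChain (fun μ μ' => ⟪μ, μ'⟫_ℝ = 1 / 3 ∨ ⟪μ, μ'⟫_ℝ = -1 / 3) κ)
    {x : EuclideanSpace ℝ (Fin 3)}
    (hob : ∀ μ ∈ κ, ⟪x, μ⟫_ℝ = Real.sqrt (2 / 3) ∨ ⟪x, μ⟫_ℝ = -Real.sqrt (2 / 3))
    {m : EuclideanSpace ℝ (Fin 3)} (hm : ‖m‖ = 1)
    (hmenu : ∀ w ∈ fccSlots, ⟪F κ w, m⟫_ℝ = 0 ∨ ⟪F κ w, m⟫_ℝ = Real.sqrt (2 / 3) ∨ ⟪F κ w, m⟫_ℝ = -Real.sqrt (2 / 3))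
    (hcross : ⟪F κ x, m⟫_ℝ = Real.sqrt (2 / 3) ∨ ⟪F κ x, m⟫_ℝ = -Real.sqrt (2 / 3)) :
    ∃ κ' : List (EuclideanSpace ℝ (Fin 3)),
      (∀ μ ∈ κ', ‖μ‖ = 1 ∧
        ∀ w ∈ fccSlots, ⟪w, μ⟫_ℝ = 0 ∨ ⟪w, μ⟫_ℝ = Real.sqrt (2 / 3) ∨ ⟪w, μ⟫_ℝ = -Real.sqrt (2 / 3)) ∧
      List.IsChain (fun μ μ' => ⟪μ, μ'⟫_ℝ = 1 / 3 ∨ ⟪μ, μ'⟫_ℝ = -1 / 3) κ' ∧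
      (∀ μ ∈ κ', ⟪x, μ⟫_ℝ = Real.sqrt (2 / 3) ∨ ⟪x, μ⟫_ℝ = -Real.sqrt (2 / 3)) ∧
      F κ x - (2 * ⟪F κ x, m⟫_ℝ) • m = F κ' x := by
  -- the model letter `μ = (F κ)⁻¹ m`
  obtain ⟨μ, hFμ, hμ1⟩ : ∃ μ : EuclideanSpace ℝ (Fin 3), F κ μ = m ∧ ‖μ‖ = 1 :=
    ⟨(F κ).symm m, (F κ).apply_symm_apply m, by rw [LinearIsometryEquiv.norm_map, hm]⟩
  have hμmenu : ∀ w ∈ fccSlots, ⟪w, μ⟫_ℝ = 0 ∨ ⟪w, μ⟫_ℝ = Real.sqrt (2 / 3) ∨ ⟪w, μ⟫_ℝ = -Real.sqrt (2 / 3) := by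
    intro w hw
    have := hmenu w hw
    rwa [← hFμ, LinearIsometryEquiv.inner_map_map] at this
  have hμob : ⟪x, μ⟫_ℝ = Real.sqrt (2 / 3) ∨ ⟪x, μ⟫_ℝ = -Real.sqrt (2 / 3) := by
    have := hcross
    rwa [← hFμ, LinearIsometryEquiv.inner_map_map] at this
  -- conjugation: `M_m (F κ x) = F κ (M_μ x) = F (μ :: κ) x`
  have hconj : F κ x - (2 * ⟪F κ x, m⟫_ℝ) • m = F (μ :: κ) x := by
    rw [word_F_cons_apply hFc hμ1 κ x, map_sub, LinearIsometryEquiv.map_smul, hFμ, ← hFμ,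
      LinearIsometryEquiv.inner_map_map]
  by_cases hcancel : ∃ ν κ₀, κ = ν :: κ₀ ∧ (μ = ν ∨ μ = -ν)
  · -- `m` is the last crossing plane: the two mirrors cancel, `κ' = tail κ`
    obtain ⟨ν, κ₀, hκν, hμν⟩ := hcancel
    subst hκν
    have hν1 : ‖ν‖ = 1 := (hκ ν (by simp)).1
    refine ⟨κ₀, fun μ' hμ' => hκ μ' (by simp [hμ']), (List.isChain_cons.1 hch).2,
      fun μ' hμ' => hob μ' (by simp [hμ']), ?_⟩
    rw [hconj, word_F_cons_apply hFc hμ1, word_F_cons_apply hFc hν1]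
    congr 1
    rcases hμν with rfl | rfl
    · exact reflect_reflect_unit hμ1 x
    · rw [reflect_neg_eq x ν]; exact reflect_reflect_unit hν1 x
  · -- genuine extension `κ' = μ :: κ`
    refine ⟨μ :: κ, ?_, ?_, ?_, hconj⟩
    · intro μ' hμ'
      rcases List.mem_cons.1 hμ' with rfl | h
      · exact ⟨hμ1, hμmenu⟩
      · exact hκ μ' h
    · rw [List.isChain_cons]
      refine ⟨fun ν hν => ?_, hch⟩
      obtain ⟨κ₀, rfl⟩ : ∃ κ₀, κ = ν :: κ₀ := by
        cases κ with
        | nil => simp at hν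
        | cons a l =>
          rw [List.head?_cons, Option.mem_def, Option.some.injEq] at hν
          exact ⟨l, by rw [hν]⟩
      have hν := hκ ν (by simp)
      have hne : μ ≠ ν := fun h => hcancel ⟨ν, κ₀, rfl, Or.inl h⟩
      have hne' : ν ≠ -μ := fun h => hcancel ⟨ν, κ₀, rfl, Or.inr (by rw [h, neg_neg])⟩
      exact menuNormals_chain_of_ne_of_ne_neg hμ1 hν.1 hμmenu hν.2 hne hne'
    · intro μ' hμ'
      rcases List.mem_cons.1 hμ' with rfl | h
      · exact hμob
      · exact hob μ' h

/-- **LEMMA X (all versions): movers from different roots have different targets.**  See the module docstring.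
The targets are given by their SHAPE only: straight `t = p + d` or cross `t = p − M_m d` along a unit menu normal `m`
of the class frame crossing `d` upward. -/
theorem word_target_ne_of_roots_ne_shape (hFc : ∀ μ κ, F (μ :: κ) = ((ℝ ∙ μ)ᗮ.reflection).trans (F κ))
    {κ₁ κ₂ : List (EuclideanSpace ℝ (Fin 3))}
    (hκ₁ : ∀ μ ∈ κ₁, ‖μ‖ = 1 ∧
      ∀ w ∈ fccSlots, ⟪w, μ⟫_ℝ = 0 ∨ ⟪w, μ⟫_ℝ = Real.sqrt (2 / 3) ∨ ⟪w, μ⟫_ℝ = -Real.sqrt (2 / 3))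
    (hκ₂ : ∀ μ ∈ κ₂, ‖μ‖ = 1 ∧
      ∀ w ∈ fccSlots, ⟪w, μ⟫_ℝ = 0 ∨ ⟪w, μ⟫_ℝ = Real.sqrt (2 / 3) ∨ ⟪w, μ⟫_ℝ = -Real.sqrt (2 / 3))
    (hch₁ : List.IsChain (fun μ μ' => ⟪μ, μ'⟫_ℝ = 1 / 3 ∨ ⟪μ, μ'⟫_ℝ = -1 / 3) κ₁)
    (hch₂ : List.IsChain (fun μ μ' => ⟪μ, μ'⟫_ℝ = 1 / 3 ∨ ⟪μ, μ'⟫_ℝ = -1 / 3) κ₂)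
    {r₁ r₂ : EuclideanSpace ℝ (Fin 3)} (hr₁ : r₁ ∈ fccSlots) (hr₂ : r₂ ∈ fccSlots) (hne : r₁ ≠ r₂) (hne' : r₁ ≠ -r₂)
    (hob₁ : ∀ μ ∈ κ₁, ⟪r₁, μ⟫_ℝ = Real.sqrt (2 / 3) ∨ ⟪r₁, μ⟫_ℝ = -Real.sqrt (2 / 3))
    (hob₂ : ∀ μ ∈ κ₂, ⟪r₂, μ⟫_ℝ = Real.sqrt (2 / 3) ∨ ⟪r₂, μ⟫_ℝ = -Real.sqrt (2 / 3))
    {c₁ c₂ : ℝ} (hc₁ : c₁ = 1 ∨ c₁ = -1) (hc₂ : c₂ = 1 ∨ c₂ = -1)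
    {d₁ d₂ : EuclideanSpace ℝ (Fin 3)} (hd₁ : d₁ = F κ₁ (c₁ • r₁)) (hd₂ : d₂ = F κ₂ (c₂ • r₂))
    {p t₁ t₂ : EuclideanSpace ℝ (Fin 3)}
    (hT₁ : t₁ = p + d₁ ∨ ∃ m : EuclideanSpace ℝ (Fin 3), ‖m‖ = 1 ∧
      (∀ w ∈ fccSlots, ⟪F κ₁ w, m⟫_ℝ = 0 ∨ ⟪F κ₁ w, m⟫_ℝ = Real.sqrt (2 / 3) ∨ ⟪F κ₁ w, m⟫_ℝ = -Real.sqrt (2 / 3)) ∧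
      ⟪d₁, m⟫_ℝ = Real.sqrt (2 / 3) ∧ t₁ = p - (d₁ - (2 * ⟪d₁, m⟫_ℝ) • m))
    (hT₂ : t₂ = p + d₂ ∨ ∃ m : EuclideanSpace ℝ (Fin 3), ‖m‖ = 1 ∧
      (∀ w ∈ fccSlots, ⟪F κ₂ w, m⟫_ℝ = 0 ∨ ⟪F κ₂ w, m⟫_ℝ = Real.sqrt (2 / 3) ∨ ⟪F κ₂ w, m⟫_ℝ = -Real.sqrt (2 / 3)) ∧
      ⟪d₂, m⟫_ℝ = Real.sqrt (2 / 3) ∧ t₂ = p - (d₂ - (2 * ⟪d₂, m⟫_ℝ) • m)) :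
    t₁ ≠ t₂ := by
  -- slots `x₁ = c₁ r₁`, `x₂ = c₂ r₂` with `x₁ ≠ ±x₂`, and obliqueness survives the sign
  have slot_of : ∀ {c : ℝ} {r : EuclideanSpace ℝ (Fin 3)}, (c = 1 ∨ c = -1) → r ∈ fccSlots → c • r ∈ fccSlots := by
    rintro c r (rfl | rfl) hr
    · rw [one_smul]; exact hr
    · rw [neg_one_smul]; exact neg_mem_fccSlots hr
  have ob_of : ∀ {c : ℝ} {r : EuclideanSpace ℝ (Fin 3)} {κ : List (EuclideanSpace ℝ (Fin 3))}, (c = 1 ∨ c = -1) →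
      (∀ μ ∈ κ, ⟪r, μ⟫_ℝ = Real.sqrt (2 / 3) ∨ ⟪r, μ⟫_ℝ = -Real.sqrt (2 / 3)) →
      ∀ μ ∈ κ, ⟪c • r, μ⟫_ℝ = Real.sqrt (2 / 3) ∨ ⟪c • r, μ⟫_ℝ = -Real.sqrt (2 / 3) := by
    rintro c r κ (rfl | rfl) hob μ hμ
    · rw [one_smul]; exact hob μ hμ
    · rw [neg_one_smul, inner_neg_left]
      rcases hob μ hμ with h | h
      · right; rw [h]
      · left; rw [h, neg_neg]
  -- `x₁ ≠ ±x₂` for ALL sign choices, as one statement on `±`-closed pairs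
  have sep : ∀ {x₁ x₂ : EuclideanSpace ℝ (Fin 3)}, (x₁ = r₁ ∨ x₁ = -r₁) → (x₂ = r₂ ∨ x₂ = -r₂) → x₁ ≠ x₂ ∧ x₁ ≠ -x₂ := by
    rintro x₁ x₂ (rfl | rfl) (rfl | rfl)
    · exact ⟨hne, hne'⟩
    · exact ⟨hne', by rw [neg_neg]; exact hne⟩
    · exact ⟨fun h => hne' (by rw [← h, neg_neg]), fun h => hne (neg_injective h)⟩
    · refine ⟨fun h => hne (neg_injective h), fun h => hne' ?_⟩
      rw [neg_neg] at h
      rw [← h, neg_neg]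
  have hx₁pm : c₁ • r₁ = r₁ ∨ c₁ • r₁ = -r₁ := by
    rcases hc₁ with rfl | rfl
    · left; rw [one_smul]
    · right; rw [neg_one_smul]
  have hx₂pm : c₂ • r₂ = r₂ ∨ c₂ • r₂ = -r₂ := by
    rcases hc₂ with rfl | rfl
    · left; rw [one_smul]
    · right; rw [neg_one_smul]
  have hx₁ := slot_of hc₁ hr₁
  have hx₂ := slot_of hc₂ hr₂
  have hob₁' := ob_of hc₁ hob₁
  have hob₂' := ob_of hc₂ hob₂
  -- every target is `p + F κ' x` (straight) or `p − F κ' x` (cross) for a chain `κ'` of the same root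
  have shape : ∀ {κ : List (EuclideanSpace ℝ (Fin 3))} {x d t : EuclideanSpace ℝ (Fin 3)},
      (∀ μ ∈ κ, ‖μ‖ = 1 ∧
        ∀ w ∈ fccSlots, ⟪w, μ⟫_ℝ = 0 ∨ ⟪w, μ⟫_ℝ = Real.sqrt (2 / 3) ∨ ⟪w, μ⟫_ℝ = -Real.sqrt (2 / 3)) →
      List.IsChain (fun μ μ' => ⟪μ, μ'⟫_ℝ = 1 / 3 ∨ ⟪μ, μ'⟫_ℝ = -1 / 3) κ →
      (∀ μ ∈ κ, ⟪x, μ⟫_ℝ = Real.sqrt (2 / 3) ∨ ⟪x, μ⟫_ℝ = -Real.sqrt (2 / 3)) → d = F κ x →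
      (t = p + d ∨ ∃ m : EuclideanSpace ℝ (Fin 3), ‖m‖ = 1 ∧
        (∀ w ∈ fccSlots, ⟪F κ w, m⟫_ℝ = 0 ∨ ⟪F κ w, m⟫_ℝ = Real.sqrt (2 / 3) ∨ ⟪F κ w, m⟫_ℝ = -Real.sqrt (2 / 3)) ∧
        ⟪d, m⟫_ℝ = Real.sqrt (2 / 3) ∧ t = p - (d - (2 * ⟪d, m⟫_ℝ) • m)) →
      ∃ κ' : List (EuclideanSpace ℝ (Fin 3)), ∃ s : ℝ, (s = 1 ∨ s = -1) ∧
        (∀ μ ∈ κ', ‖μ‖ = 1 ∧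
          ∀ w ∈ fccSlots, ⟪w, μ⟫_ℝ = 0 ∨ ⟪w, μ⟫_ℝ = Real.sqrt (2 / 3) ∨ ⟪w, μ⟫_ℝ = -Real.sqrt (2 / 3)) ∧
        List.IsChain (fun μ μ' => ⟪μ, μ'⟫_ℝ = 1 / 3 ∨ ⟪μ, μ'⟫_ℝ = -1 / 3) κ' ∧
        (∀ μ ∈ κ', ⟪x, μ⟫_ℝ = Real.sqrt (2 / 3) ∨ ⟪x, μ⟫_ℝ = -Real.sqrt (2 / 3)) ∧
        t = p + s • F κ' x := by
    intro κ x d t hκ hch hob hd hT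
    rcases hT with rfl | ⟨m, hm, hmenu, hdm, rfl⟩
    · exact ⟨κ, 1, Or.inl rfl, hκ, hch, hob, by rw [one_smul, hd]⟩
    · have hcross : ⟪F κ x, m⟫_ℝ = Real.sqrt (2 / 3) ∨ ⟪F κ x, m⟫_ℝ = -Real.sqrt (2 / 3) := by
        left; rw [← hd]; exact hdm
      obtain ⟨κ', hκ', hch', hob', heq⟩ := word_dir_reflect_eq hFc hκ hch hob hm hmenu hcross
      refine ⟨κ', -1, Or.inr rfl, hκ', hch', hob', ?_⟩
      rw [hd, heq, neg_one_smul, sub_eq_add_neg]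
  obtain ⟨κ₁', s₁, hs₁, hκ₁', hch₁', hob₁'', ht₁⟩ := shape hκ₁ hch₁ hob₁' hd₁ hT₁
  obtain ⟨κ₂', s₂, hs₂, hκ₂', hch₂', hob₂'', ht₂⟩ := shape hκ₂ hch₂ hob₂' hd₂ hT₂
  intro heq
  rw [ht₁, ht₂] at heq
  have heq' : s₁ • F κ₁' (c₁ • r₁) = s₂ • F κ₂' (c₂ • r₂) := add_left_cancel heq
  -- absorb the signs into the slots
  have hs : s₁ * s₂ = 1 ∨ s₁ * s₂ = -1 := by
    rcases hs₁ with rfl | rfl <;> rcases hs₂ with rfl | rfl <;> norm_num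
  have key : F κ₁' (c₁ • r₁) = F κ₂' ((s₁ * s₂) • (c₂ • r₂)) := by
    have hs₁sq : s₁ * s₁ = 1 := by rcases hs₁ with rfl | rfl <;> norm_num
    have e := congrArg (fun v => s₁ • v) heq'
    simp only [smul_smul, hs₁sq, one_smul] at e
    rw [e]
    exact (map_smul (F κ₂') (s₁ * s₂) (c₂ • r₂)).symm
  have hx₂' : (s₁ * s₂) • (c₂ • r₂) = r₂ ∨ (s₁ * s₂) • (c₂ • r₂) = -r₂ := by
    rcases hs with h | h <;> rcases hc₂ with h' | h' <;> rw [h, h']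
    · left; rw [one_smul, one_smul]
    · right; rw [one_smul, neg_one_smul]
    · right; rw [neg_one_smul, one_smul]
    · left; rw [neg_one_smul, neg_one_smul, neg_neg]
  obtain ⟨hn, hn'⟩ := sep hx₁pm hx₂'
  exact word_dir_ne_lists hFc hκ₁' hκ₂' hch₁' hch₂' hx₁ (slot_of hs hx₂) hn hn' hob₁'' (ob_of hs hob₂'') key

end Summit.Ventures.Crystal3D.Theorems

end
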